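import Literature.NumberTheory.Automorphic.LevelOrbitConjugationMeasure
import HarnessLib

/-!
# Pieces that do not meet are orthogonal; a translate that pairs is rational up to the levels

Registry: pub-hodgecm MODEL-CONSTRUCTION sub-cell, MODEL-DAG node **D1** (automorphic half) / E-J junction J2g;
the first step of the LEVEL-MEETING argument for geometric embeddings (after the spread formula
`pieceLiftLp_eq_sum_translate` has written both classes as sums of translates of classes at a common level, the
surviving cross terms are indexed by translates `g` lying in `M' Γ M`, i.e. RATIONAL up to the two levels).

* § 0 the group law of `translateLp` (`translateLp_mul`, `translateLp_one`) and the adjoint formulas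
  `inner_translateLp_left`, `inner_translateLp_translateLp` (`⟪g' • F', g • F⟫ = ⟪F', (g'⁻¹g) • F⟫`);
* § 1 two pieces `M' • x'`, `M • x` of `G ⧸ Γ` either meet — `∃ m' ∈ M', m ∈ M, m' • x' = m • x`
  (`not_disjoint_orbit_iff`) — or the classes of ANY two piece lifts through them are orthogonal in `L²(μ)`:
  **`inner_pieceLiftLp_eq_zero_of_disjoint`** (levels, receiving groups and projections unrelated); hence
  `exists_smul_eq_of_inner_pieceLiftLp_ne_zero`;
* § 2 with a translate: `⟪pieceLiftLp M' x' f', translateLp g (pieceLiftLp M x f)⟫ ≠ 0` forces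
  `m' • x' = (g m) • x` for some `m' ∈ M'`, `m ∈ M` (`exists_smul_eq_of_inner_translateLp_ne_zero`), and for the
  PRINCIPAL pieces `x = x' = 1Γ` it forces **`g ∈ M' Γ M`**: `exists_mem_of_inner_translateLp_ne_zero`
  (`m'⁻¹ g m ∈ Γ`) and `exists_eq_mul_of_inner_translateLp_ne_zero` (`g = m' γ m`).

Adelic reading (`G = G(𝔸)`, `Γ = G(F)`, `M = G_∞K`, `M' = G_∞K'`): a cross term `⟪φ', R(g) φ⟫` between classes
of forms of levels `K'`, `K` embedded through the principal components vanishes unless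
`g ∈ G_∞K' · G(F) · G_∞K`, in
which case `R(g) φ` is, up to the levels, the HECKE translate `R(γ) φ` by a rational element `γ`
(`translateLp_pieceLiftLp` + `smul_one_eq_of_mem`).  Everything is proved; no published statement is used as a
hypothesis (dictionary: Getz–Hahn 2024 (6.8) p. 119).
-/

set_option autoImplicit false

open _root_.MeasureTheory Set Filter Function
open scoped ENNReal InnerProductSpace

namespace Literature.NumberTheory.Automorphic

namespace LevelOrbit

noncomputable section

/-! ## § 0. The group law and adjoint formulas for `translateLp` -/

section TranslateLaws

variable (𝕜 : Type*) [NormedField 𝕜] {X : Type*} [MeasurableSpace X] {G : Type*} [Group G] [MulAction G X]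
  [MeasurableConstSMul G X] (μ : Measure X) [SMulInvariantMeasure G X μ] {E : Type*} [NormedAddCommGroup E]
  [NormedSpace 𝕜 E] (p : ℝ≥0∞)

/-- **Group law**: `translateLp (g * h) = translateLp g ∘ translateLp h`. [folklore] -/
theorem translateLp_mul (g h : G) (F : Lp E p μ) :
    translateLp 𝕜 μ p (g * h) F = translateLp 𝕜 μ p g (translateLp 𝕜 μ p h F) := by
  apply Lp.ext
  refine (coeFn_translateLp 𝕜 μ p (g * h) F).trans ?_
  refine EventuallyEq.trans (Eventually.of_forall fun y => ?_)
    ((coeFn_translateLp 𝕜 μ p g _).trans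
      ((measurePreserving_smul g⁻¹ μ).quasiMeasurePreserving.ae_eq_comp
        (coeFn_translateLp 𝕜 μ p h F))).symm
  change F ((g * h)⁻¹ • y) = F (h⁻¹ • g⁻¹ • y)
  rw [mul_inv_rev, mul_smul]

/-- `translateLp 1 = id`. [folklore] -/
theorem translateLp_one (F : Lp E p μ) : translateLp 𝕜 μ p (1 : G) F = F := by
  apply Lp.ext
  refine (coeFn_translateLp 𝕜 μ p (1 : G) F).trans (Eventually.of_forall fun y => ?_)
  change F ((1 : G)⁻¹ • y) = F y
  rw [inv_one, one_smul]

/-- `translateLp g⁻¹` undoes `translateLp g`. [folklore] -/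
theorem translateLp_inv_translateLp (g : G) (F : Lp E p μ) :
    translateLp 𝕜 μ p g⁻¹ (translateLp 𝕜 μ p g F) = F := by
  rw [← translateLp_mul, inv_mul_cancel, translateLp_one]

/-- **Adjoint formula**: `⟪g • F', F⟫ = ⟪F', g⁻¹ • F⟫` (translation is unitary on `L²`). [folklore] -/
theorem inner_translateLp_left {𝕜' : Type*} [RCLike 𝕜'] {E' : Type*} [NormedAddCommGroup E']
    [InnerProductSpace 𝕜' E'] (g : G) (F' F : Lp E' 2 μ) :
    ⟪translateLp 𝕜' μ 2 g F', F⟫_𝕜' = ⟪F', translateLp 𝕜' μ 2 g⁻¹ F⟫_𝕜' := by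
  rw [← inner_translateLp μ g⁻¹ (translateLp 𝕜' μ 2 g F') F, translateLp_inv_translateLp]

/-- **Cross terms**: `⟪g' • F', g • F⟫ = ⟪F', (g'⁻¹ * g) • F⟫`. [folklore] -/
theorem inner_translateLp_translateLp {𝕜' : Type*} [RCLike 𝕜'] {E' : Type*} [NormedAddCommGroup E']
    [InnerProductSpace 𝕜' E'] (g' g : G) (F' F : Lp E' 2 μ) :
    ⟪translateLp 𝕜' μ 2 g' F', translateLp 𝕜' μ 2 g F⟫_𝕜' = ⟪F', translateLp 𝕜' μ 2 (g'⁻¹ * g) F⟫_𝕜' := by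
  rw [inner_translateLp_left, translateLp_mul]

end TranslateLaws

/-! ## § 1. Pieces that do not meet carry orthogonal classes -/

section Meet

variable {G : Type*} [Group G] (M Γ : Subgroup G) (M' : Subgroup G)

/-- Two pieces of `G ⧸ Γ` meet iff `m' • x' = m • x` for some `m' ∈ M'`, `m ∈ M`. [folklore] -/
theorem not_disjoint_orbit_iff (x' x : G ⧸ Γ) :
    ¬ Disjoint (MulAction.orbit M' x') (MulAction.orbit M x) ↔
      ∃ (m' : M') (m : M), (m' : G) • x' = (m : G) • x := by
  rw [Set.not_disjoint_iff]
  constructor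
  · rintro ⟨y, hy', hy⟩
    obtain ⟨m', hm'⟩ := MulAction.mem_orbit_iff.mp hy'
    obtain ⟨m, hm⟩ := MulAction.mem_orbit_iff.mp hy
    exact ⟨m', m, hm'.trans hm.symm⟩
  · rintro ⟨m', m, h⟩
    exact ⟨(m : G) • x, MulAction.mem_orbit_iff.mpr ⟨m', h⟩, MulAction.mem_orbit_iff.mpr ⟨m, rfl⟩⟩

/-- For the principal base point: `m' • 1Γ = (g * m) • 1Γ ↔ m'⁻¹ g m ∈ Γ`. [folklore] -/
theorem smul_one_eq_smul_one_iff (a b : G) :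
    a • (((1 : G) : G ⧸ Γ)) = b • (((1 : G) : G ⧸ Γ)) ↔ a⁻¹ * b ∈ Γ := by
  rw [MulAction.Quotient.smul_coe, MulAction.Quotient.smul_coe, smul_eq_mul, smul_eq_mul, mul_one, mul_one,
    QuotientGroup.eq]

end Meet

section Orthogonal

variable (𝕜 : Type*) [RCLike 𝕜]
  {G : Type*} [Group G] [TopologicalSpace G] [IsTopologicalGroup G] (M Γ : Subgroup G)
  [MeasurableSpace (G ⧸ Γ)] [BorelSpace (G ⧸ Γ)]
  {G₁ : Type*} [Group G₁] [TopologicalSpace G₁] (π : M →* G₁) (x : G ⧸ Γ)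
  (M' : Subgroup G) {G₁' : Type*} [Group G₁'] [TopologicalSpace G₁'] (π' : M' →* G₁')
  (x' : G ⧸ Γ) (μ : Measure (G ⧸ Γ)) [IsFiniteMeasure μ]
  {E : Type*} [NormedAddCommGroup E] [InnerProductSpace 𝕜 E] [SecondCountableTopologyEither (G ⧸ Γ) E]
  [CompactSpace (G₁ ⧸ pieceLattice M Γ π x)] [CompactSpace (G₁' ⧸ pieceLattice M' Γ π' x')]

/-- **Pieces that do not meet carry orthogonal classes**: if `M' • x'` and `M • x` are disjoint then
`⟪pieceLiftLp M' x' f', pieceLiftLp M x f⟫ = 0` for all `f'`, `f` — whatever the levels, the receiving groups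
and the projections. [folklore] -/
theorem inner_pieceLiftLp_eq_zero_of_disjoint (hM : IsOpen (M : Set G)) (hπ : Continuous π)
    (hM' : IsOpen (M' : Set G)) (hπ' : Continuous π')
    (hdisj : Disjoint (MulAction.orbit M' x') (MulAction.orbit M x))
    (f' : C(G₁' ⧸ pieceLattice M' Γ π' x', E)) (f : C(G₁ ⧸ pieceLattice M Γ π x, E)) :
    ⟪pieceLiftLp 𝕜 M' Γ π' x' μ 2 hM' hπ' f', pieceLiftLp 𝕜 M Γ π x μ 2 hM hπ f⟫_𝕜 = 0 := by
  rw [L2.inner_def, ← integral_zero (G ⧸ Γ) 𝕜]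
  refine integral_congr_ae ?_
  filter_upwards [coeFn_pieceLiftLp 𝕜 M' Γ π' x' μ 2 hM' hπ' f', coeFn_pieceLiftLp 𝕜 M Γ π x μ 2 hM hπ f]
    with y hy' hy
  rw [hy', hy]
  by_cases h : y ∈ MulAction.orbit M x
  · have h' : y ∉ MulAction.orbit M' x' := fun h'' => Set.disjoint_left.mp hdisj h'' h
    rw [pieceLift_apply_of_not_mem _ _ _ _ _ h', inner_zero_left]
  · rw [pieceLift_apply_of_not_mem _ _ _ _ _ h, inner_zero_right]

/-- Read backwards: a non-trivial pairing forces the pieces to meet, `m' • x' = m • x`. [folklore] -/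
theorem exists_smul_eq_of_inner_pieceLiftLp_ne_zero (hM : IsOpen (M : Set G)) (hπ : Continuous π)
    (hM' : IsOpen (M' : Set G)) (hπ' : Continuous π')
    (f' : C(G₁' ⧸ pieceLattice M' Γ π' x', E)) (f : C(G₁ ⧸ pieceLattice M Γ π x, E))
    (h : ⟪pieceLiftLp 𝕜 M' Γ π' x' μ 2 hM' hπ' f', pieceLiftLp 𝕜 M Γ π x μ 2 hM hπ f⟫_𝕜 ≠ 0) :
    ∃ (m' : M') (m : M), (m' : G) • x' = (m : G) • x := by
  rw [← not_disjoint_orbit_iff]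
  exact fun hdisj =>
    h (inner_pieceLiftLp_eq_zero_of_disjoint 𝕜 M Γ π x M' π' x' μ hM hπ hM' hπ' hdisj f' f)

end Orthogonal

/-! ## § 2. A translate that pairs non-trivially is rational up to the levels -/

section Translate

variable (𝕜 : Type*) [RCLike 𝕜]
  {G : Type*} [Group G] [TopologicalSpace G] [IsTopologicalGroup G] (M Γ : Subgroup G)
  [MeasurableSpace (G ⧸ Γ)] [BorelSpace (G ⧸ Γ)]
  {G₁ : Type*} [Group G₁] [TopologicalSpace G₁] [IsTopologicalGroup G₁] (π : M →* G₁) (x : G ⧸ Γ)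
  (M' : Subgroup G) {G₁' : Type*} [Group G₁'] [TopologicalSpace G₁'] (π' : M' →* G₁')
  (x' : G ⧸ Γ) (μ : Measure (G ⧸ Γ)) [IsFiniteMeasure μ] [SMulInvariantMeasure G (G ⧸ Γ) μ]
  {E : Type*} [NormedAddCommGroup E] [InnerProductSpace 𝕜 E] [SecondCountableTopologyEither (G ⧸ Γ) E]
  [CompactSpace (G₁ ⧸ pieceLattice M Γ π x)] [CompactSpace (G₁' ⧸ pieceLattice M' Γ π' x')]

/-- **A translate that pairs forces the pieces to meet through `g`**: if
`⟪pieceLiftLp M' x' f', translateLp g (pieceLiftLp M x f)⟫ ≠ 0` then `m' • x' = (g * m) • x` for some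
`m' ∈ M'`, `m ∈ M` (the translate lives on the piece `(gMg⁻¹) • (g • x)`, `translateLp_pieceLiftLp`).
[folklore] -/
theorem exists_smul_eq_of_inner_translateLp_ne_zero (hM : IsOpen (M : Set G)) (hπ : Continuous π)
    (hM' : IsOpen (M' : Set G)) (hπ' : Continuous π') (g : G)
    (f' : C(G₁' ⧸ pieceLattice M' Γ π' x', E)) (f : C(G₁ ⧸ pieceLattice M Γ π x, E))
    (h : ⟪pieceLiftLp 𝕜 M' Γ π' x' μ 2 hM' hπ' f',
      translateLp 𝕜 μ 2 g (pieceLiftLp 𝕜 M Γ π x μ 2 hM hπ f)⟫_𝕜 ≠ 0) :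
    ∃ (m' : M') (m : M), (m' : G) • x' = (g * m) • x := by
  rw [translateLp_pieceLiftLp] at h
  obtain ⟨m', n, hn⟩ := exists_smul_eq_of_inner_pieceLiftLp_ne_zero 𝕜 (conjLevel M g) Γ (conjProj M π g)
    (g • x) M' π' x' μ (isOpen_conjLevel M hM g) (continuous_conjProj M π hπ g) hM' hπ' f' _ h
  refine ⟨m', ⟨g⁻¹ * n * g, (mem_conjLevel_iff M g n).mp n.2⟩, ?_⟩
  rw [hn, smul_smul]
  congr 1
  group

/-- **Principal pieces: the translate is rational up to the levels** — if
`⟪pieceLiftLp M' 1Γ f', translateLp g (pieceLiftLp M 1Γ f)⟫ ≠ 0` then `m'⁻¹ g m ∈ Γ` for some `m' ∈ M'`,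
`m ∈ M`. [folklore] -/
theorem exists_mem_of_inner_translateLp_ne_zero
    [CompactSpace (G₁ ⧸ pieceLattice M Γ π ((1 : G) : G ⧸ Γ))]
    [CompactSpace (G₁' ⧸ pieceLattice M' Γ π' ((1 : G) : G ⧸ Γ))]
    (hM : IsOpen (M : Set G)) (hπ : Continuous π) (hM' : IsOpen (M' : Set G)) (hπ' : Continuous π')
    (g : G)
    (f' : C(G₁' ⧸ pieceLattice M' Γ π' ((1 : G) : G ⧸ Γ), E))
    (f : C(G₁ ⧸ pieceLattice M Γ π ((1 : G) : G ⧸ Γ), E))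
    (h : ⟪pieceLiftLp 𝕜 M' Γ π' ((1 : G) : G ⧸ Γ) μ 2 hM' hπ' f',
      translateLp 𝕜 μ 2 g (pieceLiftLp 𝕜 M Γ π ((1 : G) : G ⧸ Γ) μ 2 hM hπ f)⟫_𝕜 ≠ 0) :
    ∃ (m' : M') (m : M), (m' : G)⁻¹ * (g * m) ∈ Γ := by
  obtain ⟨m', m, hmm⟩ :=
    exists_smul_eq_of_inner_translateLp_ne_zero 𝕜 M Γ π _ M' π' _ μ hM hπ hM' hπ' g f' f h
  exact ⟨m', m, (smul_one_eq_smul_one_iff Γ (m' : G) (g * m)).mp hmm⟩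

/-- The same, solved for `g`: **`g = m' * γ * m`** with `m' ∈ M'`, `γ ∈ Γ`, `m ∈ M`. [folklore] -/
theorem exists_eq_mul_of_inner_translateLp_ne_zero
    [CompactSpace (G₁ ⧸ pieceLattice M Γ π ((1 : G) : G ⧸ Γ))]
    [CompactSpace (G₁' ⧸ pieceLattice M' Γ π' ((1 : G) : G ⧸ Γ))]
    (hM : IsOpen (M : Set G)) (hπ : Continuous π) (hM' : IsOpen (M' : Set G)) (hπ' : Continuous π')
    (g : G)
    (f' : C(G₁' ⧸ pieceLattice M' Γ π' ((1 : G) : G ⧸ Γ), E))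
    (f : C(G₁ ⧸ pieceLattice M Γ π ((1 : G) : G ⧸ Γ), E))
    (h : ⟪pieceLiftLp 𝕜 M' Γ π' ((1 : G) : G ⧸ Γ) μ 2 hM' hπ' f',
      translateLp 𝕜 μ 2 g (pieceLiftLp 𝕜 M Γ π ((1 : G) : G ⧸ Γ) μ 2 hM hπ f)⟫_𝕜 ≠ 0) :
    ∃ (m' : M') (γ : Γ) (m : M), g = m' * γ * m := by
  obtain ⟨m', m, hγ⟩ :=
    exists_mem_of_inner_translateLp_ne_zero 𝕜 M Γ π M' π' μ hM hπ hM' hπ' g f' f h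
  refine ⟨m', ⟨_, hγ⟩, m⁻¹, ?_⟩
  simp only [Subgroup.coe_inv]
  group

end Translate

end

end LevelOrbit

end Literature.NumberTheory.Automorphic
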